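import Summits.Ventures.QEC.Thresholds.ToricCodeThresholdMemoryFour
import Literature.InformationTheory.QuantumCodes.ToricCodeErasureThreshold
import HarnessLib

/-!
# Certified LOSS (erasure) thresholds for the toric code: the tiers of `y_c ≥ 1/ν`

Venture QEC, `Summits/Ventures/QEC/Thresholds/` (LADDER-QEC rung Q5, second noise model: the quantum
erasure / loss channel; qec-lit-2 gen 3, filed under director-qec's standing permission for Thresholds
instance files). HONEST FRAMING: every statement below is UNCONDITIONAL and kernel-tier unless it carries
the Pönitz–Tittmann named fact `SAW.Zd.BDGS2012_connectiveConstant_two_bounds` as an explicit hypothesis;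
no `native_decide` here (the `ν = 2.688` automaton tier, `.3720`, would be a separate `--computational`
file exactly as `ToricCodeThresholdNative.lean`). This file only INSTANTIATES the Literature theorem
`ToricCode.erasureThreshold_of_sawCountBound` (`ToricCodeErasureThreshold.lean`: under `SAWCountBound C ν`,
`ν ≥ 1`, the probability that an independent loss pattern of rate `y` on the `(L+1) × (L+1)` toric code is
uncorrectable — equivalently, that some / every consistent loss decoder (maximum likelihood, peeling) can be
made to fail — tends to `0` for every `y < 1/ν`) with the walk-count inputs already used for the Pauli-noise
ladder (`ToricCodeThresholds.lean`, `ToricCodeThresholdMemoryFour.lean`):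

| tier | input | loss threshold lower bound |
|---|---|---|
| CERTIFIED (kernel) | elementary count `cₙ ≤ (4/3)3ⁿ` | `1/3` (`ToricCode.erasureThreshold_three`, Literature; = DKP15's printed `y_c^* = 1/3`) |
| CERTIFIED (kernel) | memory-4 count `cₙ ≤ 2·(26^{1/3})ⁿ` | `26^{-1/3} > .3373` (`lossThreshold_memoryFour`, `lossThreshold_0337`) |
| CERTIFIED (kernel, limit form) | Fekete `cₙ^{1/n} → μ(ℤ²)` | `1/μ(ℤ²)` exactly (`lossThreshold_inv_connectiveConstant`) |
| CONDITIONAL (PT2000 fact) | `μ(ℤ²) ≤ 2.679193` | `1/2.679193 > .3732` (`lossThreshold_PT2000_of_bounds`) |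
| VALIDATED / argued only | square-lattice bond percolation (Stace–Barrett–Doherty 2009) | `.5` — NOT a theorem here |

## References

* [StaceBarrettDoherty2009] T. M. Stace, S. D. Barrett, A. C. Doherty, PRL 102 (2009) 200501, p. 2–3.
* [DumerKovalevPryadko2015] I. Dumer, A. A. Kovalev, L. P. Pryadko, PRL 115 (2015) 050502, p. 5
  (toric code: `y_c = 0.5` vs `y_c^* = 1/3`).
* [BDGS2012] R. Bauerschmidt, H. Duminil-Copin, J. Goodman, G. Slade, *Lectures on self-avoiding walks*,
  §1.3 eqs. (1.12)–(1.14) (connective constant; `μ(ℤ²) ∈ [2.625622, 2.679193]`).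
-/

noncomputable section

namespace Summit.Ventures.QEC.Thresholds

open Filter Topology
open Literature.InformationTheory.QuantumCodes
open Literature.InformationTheory.QuantumCodes.ToricCode
open Literature.Probability.RandomPlanarGeometry

/-! ### Tier CERTIFIED: the memory-4 walk count -/

/-- **Loss threshold of the toric code `≥ 26^{-1/3}`** (kernel): instance `ν = 26^{1/3}` of
`erasureThreshold_of_sawCountBound` with the tree's memory-4 count `sawCountBound_memoryFour`.
[cite: DumerKovalevPryadko2015, p. 5 (toric erasure threshold; here sharpened from 1/3)] -/
theorem lossThreshold_memoryFour : IsThresholdLowerBound erasureFamily (1 / nuMemFour) :=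
  erasureThreshold_of_sawCountBound (le_trans (by norm_num) nuMemFour_ge) sawCountBound_memoryFour

/-- Decimal certificate: `.3373 < 26^{-1/3}`. [cite: BDGS2012, §1.3 eq. (1.13)] -/
theorem one_div_nuMemFour_gt : (0.3373 : ℝ) < 1 / nuMemFour := by
  rw [lt_div_iff₀ nuMemFour_pos]
  have h := nuMemFour_le
  nlinarith

/-- **Loss threshold of the toric code `> .3373`** (kernel, decimal form).
[cite: DumerKovalevPryadko2015, p. 5 (toric erasure threshold)] -/
theorem lossThreshold_0337 : IsThresholdLowerBound erasureFamily 0.3373 :=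
  lossThreshold_memoryFour.anti one_div_nuMemFour_gt.le

/-! ### Tier CERTIFIED, limit form: the loss threshold is at least `1/μ(ℤ²)` -/

/-- **Limit form**: if for every `ν > μ'` (`μ' ≥ 1`) some `C` has `cₙ ≤ C νⁿ`, then `1/μ'` is a
loss-threshold lower bound (for `y < 1/μ'` pick `ν` with `μ' < ν < 1/y`).
[cite: BDGS2012, §1.3 eq. (1.12) (c_n^{1/n} → μ)] -/
theorem lossThreshold_forall_gt {μ' : ℝ} (hμ' : 1 ≤ μ')
    (hc : ∀ ν : ℝ, μ' < ν → ∃ C : ℝ, SAWCountBound C ν) :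
    IsThresholdLowerBound erasureFamily (1 / μ') := by
  intro y hy0 hy
  have hμ'0 : 0 < μ' := by linarith
  rcases eq_or_lt_of_le hy0 with h0 | hypos
  · obtain ⟨C, hC⟩ := hc (μ' + 1) (by linarith)
    rw [← h0]
    exact erasureThreshold_of_sawCountBound (by linarith) hC 0 le_rfl (by positivity)
  · have h1 : μ' < 1 / y := (lt_one_div hypos hμ'0).1 hy
    set ν : ℝ := (μ' + 1 / y) / 2 with hνdef
    have hν : μ' < ν := by rw [hνdef]; linarith
    have hν' : ν < 1 / y := by rw [hνdef]; linarith
    have hν0 : 0 < ν := by linarith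
    obtain ⟨C, hC⟩ := hc ν hν
    exact erasureThreshold_of_sawCountBound (by linarith) hC y hy0 ((lt_one_div hypos hν0).2 hν')

/-- **The loss threshold of the toric code is at least `1/μ(ℤ²)`** (UNCONDITIONAL, kernel; `μ(ℤ²)` the
connective constant of the square lattice as defined in the tree, via Fekete's lemma
`SAW.Zd.tendsto_count_rpow`). [cite: StaceBarrettDoherty2009, p. 3 (loss threshold of the toric code)] -/
theorem lossThreshold_inv_connectiveConstant :
    IsThresholdLowerBound erasureFamily (1 / SAW.Zd.connectiveConstant 2) :=
  lossThreshold_forall_gt (SAW.Zd.one_le_connectiveConstant 2)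
    fun _ hν => exists_sawCountBound_of_connectiveConstant_lt hν

/-- The same as a bound on the accuracy threshold: `1/μ(ℤ²) ≤ y_c`.
[cite: StaceBarrettDoherty2009, p. 3 (loss threshold of the toric code)] -/
theorem loss_accuracyThreshold_ge_inv_connectiveConstant :
    1 / SAW.Zd.connectiveConstant 2 ≤ accuracyThreshold erasureFamily := by
  refine le_accuracyThreshold lossThreshold_inv_connectiveConstant ?_
  rw [div_le_one (lt_of_lt_of_le one_pos (SAW.Zd.one_le_connectiveConstant 2))]
  exact SAW.Zd.one_le_connectiveConstant 2

/-- Decimal, kernel: `.3373 < y_c`. [cite: DumerKovalevPryadko2015, p. 5 (toric erasure threshold)] -/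
theorem loss_accuracyThreshold_gt_0337 : (0.3373 : ℝ) < accuracyThreshold erasureFamily :=
  lt_of_lt_of_le one_div_nuMemFour_gt
    (le_accuracyThreshold lossThreshold_memoryFour (by
      rw [div_le_one nuMemFour_pos]
      exact le_trans (by norm_num) nuMemFour_ge))

/-! ### Tier CONDITIONAL: the Pönitz–Tittmann bound `μ(ℤ²) ≤ 2.679193` -/

/-- **Loss threshold `≥ 1/2.679193 > .3732`, conditional** on the named fact
`SAW.Zd.BDGS2012_connectiveConstant_two_bounds` (`μ(ℤ²) ≤ 2.679193`, Pönitz–Tittmann 2000).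
[cite: BDGS2012, §1.3 eq. (1.14)] -/
theorem lossThreshold_PT2000_of_bounds (hμ : SAW.Zd.BDGS2012_connectiveConstant_two_bounds) :
    IsThresholdLowerBound erasureFamily (1 / 2.679193) := by
  refine lossThreshold_inv_connectiveConstant.anti ?_
  have h0 : 0 < SAW.Zd.connectiveConstant 2 := lt_of_lt_of_le one_pos (SAW.Zd.one_le_connectiveConstant 2)
  exact one_div_le_one_div_of_le h0 hμ.2

/-- Decimal certificate: `.3732 < 1/2.679193`. [cite: BDGS2012, §1.3 eq. (1.14)] -/
theorem one_div_PT2000_gt : (0.3732 : ℝ) < 1 / 2.679193 := by norm_num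

/-! ### Decoder form (every consistent loss decoder: maximum likelihood / peeling) -/

/-- For EVERY family of consistent loss decoders of the toric codes, the probability that the random loss
pattern admits an error on which the decoder fails tends to `0` for all loss rates `y < 26^{-1/3}`
(kernel). [cite: DumerKovalevPryadko2015, p. 5 (toric erasure threshold)] -/
theorem lossDecoderThreshold_memoryFour (D : (L : ℕ) → ErasureDecoder (Edge (L + 1)) (Syndrome (L + 1)))
    (hD : ∀ L, (D L).IsConsistent (syn (L + 1)) (cycles (L + 1))) :
    IsThresholdLowerBound (fun L y => (D L).failureProb (syn (L + 1)) (boundaries (L + 1)) y)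
      (1 / nuMemFour) :=
  erasureDecoderThreshold_of_sawCountBound (le_trans (by norm_num) nuMemFour_ge) sawCountBound_memoryFour D hD

/-- Non-vacuity of the decoder form: the canonical loss decoders are consistent, so the statement above is
about an inhabited class (which also contains Delfosse–Zémor's linear-time peeling decoder).
[cite: DumerKovalevPryadko2015, p. 5 (toric erasure threshold)] -/
theorem lossDecoderThreshold_canonical :
    IsThresholdLowerBound
      (fun L y => (ErasureDecoder.canonical (syn (L + 1))).failureProb (syn (L + 1)) (boundaries (L + 1)) y)
      (1 / nuMemFour) :=
  lossDecoderThreshold_memoryFour (fun L => ErasureDecoder.canonical (syn (L + 1)))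
    fun L => canonical_isConsistent_toric (L + 1)

end Summit.Ventures.QEC.Thresholds
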